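import Summits.KontsevichZagierPeriods.KontsevichZagierPeriods.Theorems.TypeAGeneration.Negative.SameVariablesBridge

/-!
# `TypeAGeneration` (stmt-KontsevichZagierPeriods-18392) — room does not buy same-variable certificates

cdisprove (refuter) negative lemma for the crux `TypeAGeneration` of route
`KontsevichZagierPeriods/SymplecticScissors` (Ayoub 2015 Conj. 1.1 typed over `AyoubPeriodSeries.lean`),
aimed at the RESIDUAL of the picked line `Sketch` (card stokes-compiler): `stub_residual` is the
crux for elements of polyradius `> R` ("with room"), and the line's philosophy is that room is the
resource every certificate consumes. This file shows, kernel-checked, that NO AMOUNT OF ROOM makes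
certificates in the variables of `F` possible: for every real `R`,

* `exists_witness_family a` (`a ≥ 2`): `F_a = 1/(a + z₀) − 1/(a + 1 − z₀) ∈ 𝒪_{ℚ-alg}(𝔻̄^∞)`, in `z₀`
  only, `∫ F_a = log((a+1)/a) + log(a/(a+1)) = 0` (the reflection relation), with weighted
  coefficient sums finite for every radius `r < a` — so polyradius `≥ a`;
* `typeAGeneration_false_sameVariables_withRoom R`: it is FALSE that every one-variable kernel
  element of polyradius `> R` is a `k`-combination of type-(a) elements with certificates in `z₀`
  only (witness `k = ℚ`, `F_a` with `a > R + 1`; generic bridge of `Negative/SameVariablesBridge.lean`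
  and the simple pole `t = a + 1`).

So the auxiliary variables of the residual are intrinsic, not an artefact of small radius
(level 1 of Ayoub's Rem. 1.2, uniformly in the room). Theorems only.

References: Ayoub, Ann. of Math. 181 (2015), Conj. 1.1, Rem. 1.2, Rem. 1.5; Fresán, Journées X-UPS
2024, Rem. 3.6–3.7.
-/

noncomputable section

namespace Summit.KontsevichZagierPeriods.SymplecticScissors.TypeAGenerationNegative

open Set Finsupp
open Literature.NumberTheory.Transcendental
open Literature.NumberTheory.Transcendental.AyoubRel

/-! ## Weighted coefficient sums of the geometric germs -/

section Geo

open MvPowerSeries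

/-- The weighted coefficient sum of `1/(u − z₀)` at radius `r` is finite as soon as `‖u⁻¹‖ r < 1`
(a geometric series). [folklore] -/
theorem summable_weight_geo (u : ℂˣ) {r : ℝ} (hr0 : 0 ≤ r) (hr : ‖((u⁻¹ : ℂˣ) : ℂ)‖ * r < 1) :
    Summable fun a : ℕ →₀ ℕ =>
      ‖coeff a (rename (axisEmb 0) (PowerSeries.invUnitsSub u : MvPowerSeries Unit ℂ))‖ *
        r ^ degree a := by
  set ρ : ℝ := ‖((u⁻¹ : ℂˣ) : ℂ)‖ with hρdef
  have hρ0 : 0 ≤ ρ := norm_nonneg _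
  have hρr0 : 0 ≤ ρ * r := by positivity
  have key : Summable ((fun a : ℕ →₀ ℕ =>
      ‖coeff a (rename (axisEmb 0) (PowerSeries.invUnitsSub u : MvPowerSeries Unit ℂ))‖ *
        r ^ degree a) ∘ (single 0 : ℕ → ℕ →₀ ℕ)) := by
    have e : ((fun a : ℕ →₀ ℕ =>
        ‖coeff a (rename (axisEmb 0) (PowerSeries.invUnitsSub u : MvPowerSeries Unit ℂ))‖ *
          r ^ degree a) ∘ (single 0 : ℕ → ℕ →₀ ℕ)) = fun n => ρ * (ρ * r) ^ n := by
      funext n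
      simp only [Function.comp_apply]
      rw [coeff_geo_single, degree_single, norm_pow, pow_succ, mul_pow]
      ring
    rw [e]
    exact (summable_geometric_of_lt_one hρr0 hr).mul_left ρ
  refine (Function.Injective.summable_iff (single_injective 0) ?_).mp key
  intro x hx
  rw [coeff_geo_of_ne, norm_zero, zero_mul]
  intro n hn
  exact hx ⟨n, hn.symm⟩

end Geo

/-! ## The family `F_a = 1/(a + z₀) − 1/(a + 1 − z₀)` -/

section Family

open MvPowerSeries

/-- **The witness family.** For a natural number `a ≥ 2` there is `F ∈ 𝒪_{ℚ-alg}(𝔻̄^∞)` in the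
variable `z₀` only with `∫ F = 0`, weighted coefficient sums finite at every radius `r < a`
(polyradius `≥ a`), and the Taylor coefficients of `1/(a + z) − 1/(a + 1 − z)`:
`a⁻¹(−a⁻¹)ⁿ − (a+1)⁻¹((a+1)⁻¹)ⁿ` on the axis, `0` off it (`F = −1/((−a) − z₀) − 1/((a+1) − z₀)`;
`∫ F = log((a+1)/a) + log(a/(a+1)) = 0`). [cite: Ayoub2015, Rem. 1.5] -/
theorem exists_witness_family (a : ℕ) (ha : 2 ≤ a) :
    ∃ F : CSeries, F ∈ Oan (algebraMap ℚ ℂ) ∧ DependsOnlyOnLT F 1 ∧ intC F = 0 ∧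
      (∀ r : ℝ, 0 ≤ r → r < a → Summable fun b : ℕ →₀ ℕ => ‖coeff b F‖ * r ^ degree b) ∧
      (∀ n : ℕ, coeff (single 0 n) F =
        (((1 / a : ℝ) * (-1 / a) ^ n - (1 / (a + 1)) * (1 / (a + 1)) ^ n : ℝ) : ℂ)) ∧
      (∀ b : ℕ →₀ ℕ, (∀ n, b ≠ single 0 n) → coeff b F = 0) := by
  have ha0 : (0 : ℝ) < a := by exact_mod_cast (show 0 < a by omega)
  have haC : (a : ℂ) ≠ 0 := by exact_mod_cast (show (a : ℕ) ≠ 0 by omega)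
  have haC1 : (a : ℂ) + 1 ≠ 0 := by exact_mod_cast (show (a : ℕ) + 1 ≠ 0 by omega)
  set u₁ : ℂˣ := Units.mk0 (-(a : ℂ)) (neg_ne_zero.mpr haC) with hu₁
  set u₂ : ℂˣ := Units.mk0 ((a : ℂ) + 1) haC1 with hu₂
  have hi₁ : ((u₁⁻¹ : ℂˣ) : ℂ) = ((-1 / a : ℝ) : ℂ) := by
    rw [Units.val_inv_eq_inv_val, hu₁, Units.val_mk0]; push_cast; field_simp
  have hi₂ : ((u₂⁻¹ : ℂˣ) : ℂ) = ((1 / (a + 1) : ℝ) : ℂ) := by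
    rw [Units.val_inv_eq_inv_val, hu₂, Units.val_mk0]; push_cast; field_simp
  have hni₁ : ‖((u₁⁻¹ : ℂˣ) : ℂ)‖ = 1 / a := by
    rw [hi₁, Complex.norm_real, Real.norm_eq_abs, abs_div, abs_neg, abs_one,
      abs_of_pos ha0]
  have hni₂ : ‖((u₂⁻¹ : ℂˣ) : ℂ)‖ = 1 / (a + 1) := by
    rw [hi₂, Complex.norm_real, Real.norm_eq_abs, abs_of_pos (by positivity)]
  have ha1 : (1 : ℝ) < a := by exact_mod_cast (show 1 < a by omega)
  have hn₁ : ‖((u₁⁻¹ : ℂˣ) : ℂ)‖ < 1 := by rw [hni₁, div_lt_one ha0]; exact ha1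
  have hn₂ : ‖((u₂⁻¹ : ℂˣ) : ℂ)‖ < 1 := by
    rw [hni₂, div_lt_one (by positivity)]; linarith
  have halg₁ : ∃ p : Polynomial ℚ, p ≠ 0 ∧ Polynomial.eval₂ (algebraMap ℚ ℂ) (u₁ : ℂ) p = 0 :=
    ⟨Polynomial.X - Polynomial.C (-(a : ℚ)), Polynomial.X_sub_C_ne_zero _, by
      rw [hu₁, Units.val_mk0]; simp⟩
  have halg₂ : ∃ p : Polynomial ℚ, p ≠ 0 ∧ Polynomial.eval₂ (algebraMap ℚ ℂ) (u₂ : ℂ) p = 0 :=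
    ⟨Polynomial.X - Polynomial.C ((a : ℚ) + 1), Polynomial.X_sub_C_ne_zero _, by
      rw [hu₂, Units.val_mk0]; simp⟩
  set g₁ : CSeries := rename (axisEmb 0) (PowerSeries.invUnitsSub u₁ : MvPowerSeries Unit ℂ) with hg₁
  set g₂ : CSeries := rename (axisEmb 0) (PowerSeries.invUnitsSub u₂ : MvPowerSeries Unit ℂ) with hg₂
  have hm₁ : g₁ ∈ Oan (algebraMap ℚ ℂ) := geo_mem_Oan u₁ _ halg₁ hn₁
  have hm₂ : g₂ ∈ Oan (algebraMap ℚ ℂ) := geo_mem_Oan u₂ _ halg₂ hn₂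
  refine ⟨-g₁ - g₂, sub_mem_Oan _ (neg_mem_Oan _ hm₁) hm₂, ?_, ?_, ?_, ?_, ?_⟩
  · intro b hb
    rw [map_sub, map_neg, dependsOnlyOnLT_geo u₁ b hb, dependsOnlyOnLT_geo u₂ b hb]
    simp
  · rw [intC_sub (summable_norm_coeff_of_mem_Oan _ (neg_mem_Oan _ hm₁))
      (summable_norm_coeff_of_mem_Oan _ hm₂), ← neg_one_smul ℂ g₁, intC_smul,
      hg₁, hg₂, intC_geo u₁ hn₁, intC_geo u₂ hn₂, hi₁, hi₂]
    have e1 : (1 - ((-1 / a : ℝ) : ℂ)) = (((a + 1) / a : ℝ) : ℂ) := by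
      push_cast; field_simp; ring
    have e2 : (1 - ((1 / (a + 1) : ℝ) : ℂ)) = ((a / (a + 1) : ℝ) : ℂ) := by
      push_cast; field_simp; ring
    rw [e1, e2, ← Complex.ofReal_log (by positivity), ← Complex.ofReal_log (by positivity)]
    have h : Real.log ((a + 1) / a) + Real.log (a / (a + 1)) = 0 := by
      rw [← Real.log_mul (by positivity) (by positivity)]
      rw [show ((a : ℝ) + 1) / a * (a / (a + 1)) = 1 by field_simp]
      exact Real.log_one
    have h' : (Real.log (a / (a + 1)) : ℂ) = -(Real.log ((a + 1) / a) : ℂ) := by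
      rw [← Complex.ofReal_neg]
      congr 1
      linarith
    rw [h']
    ring
  · intro r hr0 hra
    have hs₁ : Summable fun b : ℕ →₀ ℕ => ‖coeff b g₁‖ * r ^ degree b := by
      refine summable_weight_geo u₁ hr0 ?_
      rw [hni₁, div_mul_eq_mul_div, one_mul, div_lt_one ha0]; exact hra
    have hs₂ : Summable fun b : ℕ →₀ ℕ => ‖coeff b g₂‖ * r ^ degree b := by
      refine summable_weight_geo u₂ hr0 ?_
      rw [hni₂, div_mul_eq_mul_div, one_mul, div_lt_one (by positivity)]; linarith
    refine (hs₁.add hs₂).of_nonneg_of_le (fun b => by positivity) fun b => ?_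
    rw [map_sub, map_neg, ← add_mul]
    refine mul_le_mul_of_nonneg_right ?_ (by positivity)
    calc ‖-coeff b g₁ - coeff b g₂‖ ≤ ‖-coeff b g₁‖ + ‖coeff b g₂‖ := norm_sub_le _ _
      _ = ‖coeff b g₁‖ + ‖coeff b g₂‖ := by rw [norm_neg]
  · intro n
    rw [map_sub, map_neg, hg₁, hg₂, coeff_geo_single, coeff_geo_single, hi₁, hi₂]
    push_cast
    ring
  · intro b hb
    rw [map_sub, map_neg, hg₁, hg₂, coeff_geo_of_ne u₁ hb, coeff_geo_of_ne u₂ hb]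
    simp

end Family

/-! ## The real germ and the simple pole at `t = a + 1` -/

/-- The real Taylor series of `1/(a + t) − 1/(a + 1 − t)` on `[−1, 1]` (`a ≥ 2`). [folklore] -/
theorem hasSum_family_real {a : ℕ} (ha : 2 ≤ a) {t : ℝ} (ht : |t| ≤ 1) :
    HasSum (fun n : ℕ => ((1 / a : ℝ) * (-1 / a) ^ n - (1 / (a + 1)) * (1 / (a + 1)) ^ n) * t ^ n)
      (1 / (a + t) - 1 / (a + 1 - t)) := by
  have ha0 : (0 : ℝ) < a := by exact_mod_cast (show 0 < a by omega)
  have ha2 : (2 : ℝ) ≤ a := by exact_mod_cast ha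
  have ha' : (a : ℝ) ≠ 0 := ha0.ne'
  have ha1' : (a : ℝ) + 1 ≠ 0 := by positivity
  have ht1 : -1 ≤ t ∧ t ≤ 1 := abs_le.mp ht
  have h1 : HasSum (fun n : ℕ => (-t / a) ^ n) (1 - (-t / a))⁻¹ := by
    refine hasSum_geometric_of_abs_lt_one ?_
    rw [abs_div, abs_neg, abs_of_pos ha0, div_lt_one ha0]
    linarith
  have h2 : HasSum (fun n : ℕ => (t / (a + 1)) ^ n) (1 - t / (a + 1))⁻¹ := by
    refine hasSum_geometric_of_abs_lt_one ?_
    rw [abs_div, abs_of_pos (by positivity : (0 : ℝ) < a + 1), div_lt_one (by positivity)]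
    linarith
  have h := (h1.mul_left (1 / (a : ℝ))).sub (h2.mul_left (1 / ((a : ℝ) + 1)))
  have e1 : (1 : ℝ) - -t / a = (a + t) / a := by
    rw [neg_div, sub_neg_eq_add]; field_simp
  have e2 : (1 : ℝ) - t / (a + 1) = (a + 1 - t) / (a + 1) := by field_simp
  have e : (1 / a : ℝ) * (1 - -t / a)⁻¹ - 1 / (a + 1) * (1 - t / (a + 1))⁻¹ =
      1 / (a + t) - 1 / (a + 1 - t) := by
    rw [e1, e2, inv_div, inv_div, mul_div_assoc', one_div_mul_cancel ha', mul_div_assoc',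
      one_div_mul_cancel ha1']
  rw [e] at h
  refine h.congr_fun fun n => ?_
  rw [show (-t / a : ℝ) = (-1 / a) * t by ring, show (t / (a + 1) : ℝ) = (1 / (a + 1)) * t by ring,
    mul_pow, mul_pow]
  ring

/-! ## The negative lemma, uniformly in the room -/

open Polynomial in
/-- **Room does not buy same-variable certificates.** For every real `R` it is FALSE that every
one-variable kernel element `F ∈ 𝒪_{k-alg}(𝔻̄^∞)` (`F` in `z₀` only, `∫ F = 0`) of polyradius `> R`
(weighted coefficient sum finite at some radius `r > R`, the shape of the residual `stub_residual` of
line `Sketch`) is a `k`-combination of type-(a) elements `∂G/∂zᵢ − G|_{zᵢ=1} + G|_{zᵢ=0}` with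
`G ∈ 𝒪_{k-alg}(𝔻̄^∞)` in `z₀` only: witness `k = ℚ`, `F = 1/(a + z₀) − 1/(a + 1 − z₀)` with
`a > R + 1` (bridge to a `ℚ`-semialgebraic primitive of `f + C` on `[0,1]`, killed by the simple pole
`t = a + 1`: `((X − (a+1))(X + a))·(f + C) = 2X − 1 + C(X − (a+1))(X + a)`, value `2a + 1 ≠ 0`).
[cite: Ayoub2015, Rem. 1.2 and Rem. 1.5] -/
theorem typeAGeneration_false_sameVariables_withRoom (R : ℝ) :
    ¬ (∀ (k : Type) [Field k] [CharZero k] (σ : k →+* ℂ), (∀ c : k, IsAlgebraic ℚ (σ c)) →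
        ∀ F ∈ Oan σ, DependsOnlyOnLT F 1 →
          (∃ r : ℝ, R < r ∧
            Summable fun b : ℕ →₀ ℕ => ‖MvPowerSeries.coeff b F‖ * r ^ degree b) →
          intC F = 0 →
            F ∈ kSpan σ {x : CSeries | ∃ G ∈ Oan σ, DependsOnlyOnLT G 1 ∧ ∃ i : ℕ, x = relAC i G}) := by
  intro h
  -- a natural number `a ≥ 2` with `R + 1 < a`
  obtain ⟨a, ha2, haR⟩ : ∃ a : ℕ, 2 ≤ a ∧ R + 1 < a := by
    refine ⟨⌈|R|⌉₊ + 2, by omega, ?_⟩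
    have h1 : |R| ≤ ⌈|R|⌉₊ := Nat.le_ceil _
    have h2 : R ≤ |R| := le_abs_self R
    push_cast
    linarith
  have ha0 : (0 : ℝ) < a := by exact_mod_cast (show 0 < a by omega)
  obtain ⟨F, hFO, hF1, hF0, hFw, hFc, hFz⟩ := exists_witness_family a ha2
  have ha1r : (1 : ℝ) ≤ a := by exact_mod_cast (show 1 ≤ a by omega)
  have hroom : ∃ r : ℝ, R < r ∧
      Summable fun b : ℕ →₀ ℕ => ‖MvPowerSeries.coeff b F‖ * r ^ degree b :=
    ⟨a - 1, by linarith, hFw (a - 1) (by linarith) (by linarith)⟩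
  have hmem := h ℚ (algebraMap ℚ ℂ) (fun c => isAlgebraic_algebraMap c) F hFO hF1 hroom hF0
  obtain ⟨C, g, hg, hd⟩ := exists_semialgebraic_primitive_of_mem_kSpan_oneVar hFc hFz
    (fun t ht => hasSum_family_real ha2 (abs_le.mpr ⟨by linarith [ht.1], ht.2⟩))
    (mem_kSpan_relAC_zero_of_mem_kSpan_oneVar _ hmem)
  refine no_semialgebraic_primitive_of_simple_pole (h := fun t => 1 / (a + t) - 1 / (a + 1 - t))
    (x₀ := (a : ℝ) + 1) (V := X + Polynomial.C (a : ℝ))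
    (fun C' => Polynomial.C (2 : ℝ) * X - Polynomial.C 1 +
      Polynomial.C C' * (X - Polynomial.C ((a : ℝ) + 1)) * (X + Polynomial.C (a : ℝ)))
    ?_ ?_ ?_ C g hg hd
  · rw [eval_add, eval_X, eval_C]; linarith
  · intro C'
    simp only [eval_add, eval_sub, eval_mul, eval_X, eval_C]
    nlinarith
  · intro C' t ht
    have hat : (a : ℝ) + t ≠ 0 := by have := ht.1; intro h; linarith
    have hat' : (a : ℝ) + 1 - t ≠ 0 := by have := ht.2; intro h; linarith
    simp only [eval_mul, eval_add, eval_sub, eval_X, eval_C]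
    field_simp
    ring

end Summit.KontsevichZagierPeriods.SymplecticScissors.TypeAGenerationNegative
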